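import Mathlib
import HarnessLib

/-!
# `NoHeavyLowerTail` (stmt-CriticalPhenomena-4575) — class-words: the mass of the patterns supported on a set of stars

Support file (prover `prim-gen-swap` gen 11; `--supports stmt-CriticalPhenomena-4575`).  No definitions, no named facts, no sorries.

First brick of §1 ("the word budget at class level") of the seat memo U1-PROOF.md.  Hair patterns are maps `e : Fin m → Fin 3`
(`0` unglued, `1`/`2` glued to the first/second port) with multiplicative coefficients `Π_i c_i(e_i)`.  For a set `U` of stars and a
prescribed nonzero value `k_i` for each star, the patterns supported in `U` whose glued stars take their prescribed value have total mass
`Π_{i∉U} c_i(0) · Π_{i∈U} (c_i(0) + c_i(k_i))` — the product expansion behind the CLASS ODDS `O_{X,d} = Π_{i∈X}(1+o_{i,d}) − 1` of U1-PROOF.md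
(combine with `StarSet.classWeight_mul_prod_coeffZero_le` and `StarSet.classOdds_mul_ge_sq_sum_phi`).

* `StarSet.prod_pattern_of_subset` — the coefficient of the pattern "`k` on `t`, `0` elsewhere" splits as `Π_{t} c(k) · Π_{U∖t} c(0) · Π_{∉U} c(0)`;
* `StarSet.sum_patterns_supported_eq_prod` — `Σ_{e : supp e ⊆ U, e = k on supp} Π_i c_i(e_i) = Π_{i∉U} c_i(0) · Π_{i∈U}(c_i(0)+c_i(k_i))`;
* `StarSet.sum_patterns_supported_ne_zero_eq` — the same without the all-unglued pattern (`C0·O_{X,d}` for one class).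
-/

namespace Summit.CriticalPhenomena.PercolationContinuityZ3.Theorems

open Finset
open scoped BigOperators

namespace StarSet

variable {m : ℕ}

/-- The coefficient of the pattern equal to `k` on `t ⊆ U` and `0` elsewhere. [U1-PROOF.md §1] -/
theorem prod_pattern_of_subset (c : Fin m → Fin 3 → ℝ) (k : Fin m → Fin 3) (U t : Finset (Fin m)) (ht : t ⊆ U) :
    ∏ i, c i (if i ∈ t then k i else 0) = ((∏ i ∈ t, c i (k i)) * ∏ i ∈ U \ t, c i 0) * ∏ i ∈ univ \ U, c i 0 := by
  classical
  rw [← prod_sdiff (subset_univ U), mul_comm]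
  congr 1
  · rw [← prod_sdiff ht, mul_comm]
    congr 1
    · exact prod_congr rfl fun i hi => by rw [if_pos hi]
    · exact prod_congr rfl fun i hi => by rw [if_neg (mem_sdiff.1 hi).2]
  · refine prod_congr rfl fun i hi => ?_
    rw [if_neg fun h => (mem_sdiff.1 hi).2 (ht h)]

/-- **Mass of the patterns supported in `U` with prescribed glued values.**  See the file header. [U1-PROOF.md §1, L1.1 set-up] -/
theorem sum_patterns_supported_eq_prod (c : Fin m → Fin 3 → ℝ) (U : Finset (Fin m)) (k : Fin m → Fin 3) (hk : ∀ i, k i ≠ 0) :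
    ∑ e ∈ (univ : Finset (Fin m → Fin 3)).filter (fun e => ∀ i, (i ∉ U → e i = 0) ∧ (i ∈ U → (e i = 0 ∨ e i = k i))),
        ∏ i, c i (e i) =
      (∏ i ∈ univ \ U, c i 0) * ∏ i ∈ U, (c i 0 + c i (k i)) := by
  classical
  have hcomm : ∏ i ∈ U, (c i 0 + c i (k i)) = ∏ i ∈ U, (c i (k i) + c i 0) := prod_congr rfl fun i _ => add_comm _ _
  rw [hcomm, prod_add, mul_sum]
  symm
  refine sum_bij' (fun t _ => fun i => if i ∈ t then k i else 0) (fun e _ => U.filter fun i => e i ≠ 0) ?_ ?_ ?_ ?_ ?_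
  · -- the pattern of `t ⊆ U` is admissible
    intro t ht
    have htU : t ⊆ U := mem_powerset.1 ht
    simp only [mem_filter, mem_univ, true_and]
    intro i
    refine ⟨fun hiU => ?_, fun _ => ?_⟩
    · rw [if_neg fun hit => hiU (htU hit)]
    · by_cases hit : i ∈ t
      · exact Or.inr (by rw [if_pos hit])
      · exact Or.inl (by rw [if_neg hit])
  · -- the support of an admissible pattern is a subset of `U`
    intro e _
    exact mem_powerset.2 (filter_subset _ _)
  · -- left inverse
    intro t ht
    have htU : t ⊆ U := mem_powerset.1 ht
    ext i
    simp only [mem_filter]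
    constructor
    · rintro ⟨_, h⟩
      by_contra hit
      exact h (by rw [if_neg hit])
    · intro hit
      exact ⟨htU hit, by rw [if_pos hit]; exact hk i⟩
  · -- right inverse
    intro e he
    simp only [mem_filter, mem_univ, true_and] at he
    funext i
    by_cases hiU : i ∈ U
    · rcases (he i).2 hiU with h0 | hk'
      · rw [if_neg (by simp [mem_filter, h0]), h0]
      · have hne : e i ≠ 0 := by rw [hk']; exact hk i
        rw [if_pos (mem_filter.2 ⟨hiU, hne⟩), hk']
    · rw [if_neg (by simp [mem_filter, hiU]), (he i).1 hiU]
  · -- the summands agree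
    intro t ht
    have htU : t ⊆ U := mem_powerset.1 ht
    rw [prod_pattern_of_subset c k U t htU]
    ring

/-- **… minus the all-unglued pattern**: the patterns supported in `U`, with prescribed glued values and at least one glued star, have mass
`Π_{i∉U} c_i(0)·Π_{i∈U}(c_i(0)+c_i(k_i)) − Π_i c_i(0)` (for `U` = the stars of one class this is `C0·O_{X,d}` of U1-PROOF.md §1). -/
theorem sum_patterns_supported_ne_zero_eq (c : Fin m → Fin 3 → ℝ) (U : Finset (Fin m)) (k : Fin m → Fin 3) (hk : ∀ i, k i ≠ 0) :
    ∑ e ∈ (univ : Finset (Fin m → Fin 3)).filter (fun e => ∀ i, (i ∉ U → e i = 0) ∧ (i ∈ U → (e i = 0 ∨ e i = k i))) \ {fun _ => 0},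
        ∏ i, c i (e i) =
      (∏ i ∈ univ \ U, c i 0) * ∏ i ∈ U, (c i 0 + c i (k i)) - ∏ i, c i 0 := by
  classical
  have hz : ({fun _ => (0 : Fin 3)} : Finset (Fin m → Fin 3)) ⊆
      (univ : Finset (Fin m → Fin 3)).filter (fun e => ∀ i, (i ∉ U → e i = 0) ∧ (i ∈ U → (e i = 0 ∨ e i = k i))) := by
    intro e he
    rw [mem_singleton] at he
    subst he
    simp
  rw [sum_sdiff_eq_sub hz, sum_singleton, sum_patterns_supported_eq_prod c U k hk]

end StarSet

end Summit.CriticalPhenomena.PercolationContinuityZ3.Theorems
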